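import Literature.Computability.AlgebraicComplexity.DetReprEquivalent
import Literature.Computability.AlgebraicComplexity.LandsbergRessayre

/-! # Crux `UniqStep` (stmt-ValiantsHypothesis-17834), line `Sketch` — stub `stub_swapBookkeeping`:
# variable-transpose bookkeeping for the permanent

WHAT. Two bookkeeping facts about the transposition `x ↦ xᵀ` of the `N²` variables `x_{ij}` of
`per_N = perPoly (Fin N) ℂ`, i.e. the renaming `rename Prod.swap`:

* (a) `rename_swap_perPoly`: `per_N (xᵀ) = per_N` — the renamed polynomial is the permanent of the
  transposed generic matrix, and `Matrix.permanent_transpose`.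
* (b) `detReprEquivalent_map_rename_swap`: every square matrix `A` of polynomials in the `x_{ij}` is
  `DetReprEquivalent (permSymmetrySubst ℂ N)` to its variable-transpose `A.map (rename Prod.swap)`.
  Indeed the permutation matrix `τ` of `Prod.swap` (an involution, so `τ ∈ GL(N²)`,
  `exists_mem_transposeSubstSet`) is the element of `transposeSubstSet ℂ N ⊆ permSymmetrySubst ℂ N`
  (Landsberg–Ressayre's `ℤ₂`), and it acts on entries by `A(τ·x) = A.map (rename Prod.swap)`
  (`linSubst_permMatrix`), so (b) is the generator `A ~ A(γ·x)` (`detReprEquivalent_linSubstEntries`)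
  of the equivalence relation.

WHY. Stub S6 of the line: the bet `stub_symForced` concludes that an optimal projection `B` of
`per_{n+1}` OR ITS VARIABLE-TRANSPOSE is `leftMonomialSubst`-equivariant; in the second case the
composition `UniqStep_of` replaces `B` by `B.map (rename Prod.swap)`, which has the same determinant
by (a) and lies in the same `permSymmetrySubst`-class by (b).

SOURCE. Folklore (`per (Xᵀ) = per X`); J. M. Landsberg, N. Ressayre, *Permanent v. determinant: an
exponential lower bound assuming symmetry*, Differential Geom. Appl. 55 (2017), §2.1 (the `ℤ₂` of
`G_{perm_m}`; key `LandsbergRessayre2017`). The computations `τ² = 1`, `A(τ·x) = A.map (rename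
Prod.swap)` and (a) are adapted from the sibling crux's theorem file
`Summits/ValiantsHypothesis/ValiantsHypothesis/Theorems/ProjectionStabilityOptStepStubHalfEqTransportSymm.lean`
(kept local here to avoid importing its heavier dependencies).
-/

-- D-0017 layout: Sub = Summit for this single-conjunct summit, so the namespace repeats a component.
set_option linter.dupNamespace false

namespace Summit.ValiantsHypothesis.ValiantsHypothesis.Theorems.ProjectionStabilityUniqStep

open MvPolynomial
open scoped BigOperators Matrix
open Literature.Computability.AlgebraicComplexity

noncomputable section

/-! ### (a) The permanent is invariant under transposing its variables -/

-- adapted from `rename_swap_perPoly` in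
-- Summits/ValiantsHypothesis/ValiantsHypothesis/Theorems/ProjectionStabilityOptStepStubHalfEqTransportSymm.lean
/-- `per_N (xᵀ) = per_N`: renaming `x_{ij} ↦ x_{ji}` turns the generic matrix into its transpose, and
the permanent is transpose-invariant (`Matrix.permanent_transpose`). [folklore] -/
theorem rename_swap_perPoly (N : ℕ) :
    rename (Prod.swap : Fin N × Fin N → Fin N × Fin N) (perPoly (Fin N) ℂ) = perPoly (Fin N) ℂ := by
  have h : rename (Prod.swap : Fin N × Fin N → Fin N × Fin N) (perPoly (Fin N) ℂ) =
      ((Matrix.mvPolynomialX (Fin N) (Fin N) ℂ).transpose).permanent := by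
    simp [perPoly, Matrix.permanent, map_sum, map_prod, Matrix.mvPolynomialX, rename_X]
  rw [h, Matrix.permanent_transpose]
  rfl

/-! ### (b) The transposition substitution `τ ∈ transposeSubstSet ⊆ permSymmetrySubst` -/

/-- The permutation matrix of `Prod.swap` on `Fin N × Fin N` (the substitution `x ↦ xᵀ`) squares to
`1`. [folklore] -/
theorem swapPermMatrix_mul_self (N : ℕ) :
    Equiv.Perm.permMatrix ℂ (Equiv.prodComm (Fin N) (Fin N)) *
        Equiv.Perm.permMatrix ℂ (Equiv.prodComm (Fin N) (Fin N)) =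
      (1 : Matrix (Fin N × Fin N) (Fin N × Fin N) ℂ) := by
  rw [← Matrix.permMatrix_mul, show Equiv.prodComm (Fin N) (Fin N) * Equiv.prodComm (Fin N) (Fin N) =
      (1 : Equiv.Perm (Fin N × Fin N)) from Equiv.ext fun x => by simp [Equiv.Perm.mul_apply],
    Matrix.permMatrix_one]

/-- The transposition substitution `τ : x ↦ xᵀ` as an element of `GL(N²)` (its own inverse).
Landsberg–Ressayre 2017, §2.1 (the `ℤ₂` of `G_{perm_m}`). [cite: LandsbergRessayre2017, §2.1] -/
theorem exists_mem_transposeSubstSet (N : ℕ) :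
    ∃ τ : GL (Fin N × Fin N) ℂ, τ ∈ transposeSubstSet ℂ N :=
  ⟨⟨_, _, swapPermMatrix_mul_self N, swapPermMatrix_mul_self N⟩, rfl⟩

/-- `transposeSubstSet ⊆ permSymmetrySubst` (the third generating set).
[cite: LandsbergRessayre2017, §2.1] -/
theorem transposeSubstSet_subset_permSymmetrySubst (N : ℕ) :
    transposeSubstSet ℂ N ⊆ (permSymmetrySubst ℂ N : Set (GL (Fin N × Fin N) ℂ)) :=
  fun _ hγ => Subgroup.subset_closure (Or.inr hγ)

/-- Substituting `τ ∈ transposeSubstSet` into the entries of a matrix of polynomials is the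
variable-transpose: `A(τ·x) = A.map (rename Prod.swap)` (`linSubst_permMatrix`: the permutation
matrix of `P` acts by `rename P.symm`, and `Prod.swap` is an involution). [folklore] -/
theorem linSubstEntries_of_mem_transposeSubstSet {N : ℕ} {τ : GL (Fin N × Fin N) ℂ}
    (hτ : τ ∈ transposeSubstSet ℂ N) {ι : Type*}
    (A : Matrix ι ι (MvPolynomial (Fin N × Fin N) ℂ)) :
    Matrix.linSubstEntries τ A = A.map (rename Prod.swap) := by
  have hcoe : (τ : Matrix (Fin N × Fin N) (Fin N × Fin N) ℂ) =
      Equiv.Perm.permMatrix ℂ (Equiv.prodComm (Fin N) (Fin N)) := hτ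
  rw [Matrix.linSubstEntries, hcoe, linSubst_permMatrix, Equiv.prodComm_symm, Equiv.coe_prodComm]

/-- **(b)** Every square matrix of polynomials in the `x_{ij}` is `permSymmetrySubst`-equivalent to
its variable-transpose: `A.map (rename Prod.swap) = A(τ·x)` with `τ ∈ permSymmetrySubst`, a generator
of `DetReprEquivalent`. [folklore] -/
theorem detReprEquivalent_map_rename_swap (N : ℕ) {ι : Type*} [Fintype ι] [DecidableEq ι]
    (A : Matrix ι ι (MvPolynomial (Fin N × Fin N) ℂ)) :
    DetReprEquivalent (permSymmetrySubst ℂ N) A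
      (A.map (rename (Prod.swap : Fin N × Fin N → Fin N × Fin N))) := by
  obtain ⟨τ, hτ⟩ := exists_mem_transposeSubstSet N
  rw [← linSubstEntries_of_mem_transposeSubstSet hτ A]
  exact detReprEquivalent_linSubstEntries A (transposeSubstSet_subset_permSymmetrySubst N hτ)

/-! ### The registered stub -/

/-- **STUB S6** of line `Sketch` of crux `UniqStep` — variable-transpose bookkeeping: (a) `per_N` is
invariant under the transposition of its variables; (b) every matrix of polynomials is
`DetReprEquivalent (permSymmetrySubst ℂ N)` to its variable-transpose `A.map (rename Prod.swap)`
(the substitution `τ ∈ transposeSubstSet ⊆ permSymmetrySubst` acts on entries as `rename Prod.swap`).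
[folklore] -/
theorem stub_swapBookkeeping :
    (∀ N : ℕ, rename (Prod.swap : Fin N × Fin N → Fin N × Fin N) (perPoly (Fin N) ℂ) = perPoly (Fin N) ℂ) ∧
    (∀ (N m : ℕ) (A : Matrix (Fin m) (Fin m) (MvPolynomial (Fin N × Fin N) ℂ)),
      DetReprEquivalent (permSymmetrySubst ℂ N) A
        (A.map (rename (Prod.swap : Fin N × Fin N → Fin N × Fin N)))) :=
  ⟨rename_swap_perPoly, fun N _ A => detReprEquivalent_map_rename_swap N A⟩

end

end Summit.ValiantsHypothesis.ValiantsHypothesis.Theorems.ProjectionStabilityUniqStep
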